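import Summits.QuantumFields.BalabanUV.Beta.SecondOrderDefectWordsSep
import Summits.QuantumFields.BalabanUV.Beta.SecondOrderClassStep
import Summits.QuantumFields.BalabanUV.Beta.SymSecondOrderSplitLoc
import Summits.QuantumFields.BalabanUV.Beta.SymSecondOrderRemainderAn1

/-!
# `BalabanUV.Beta.SymSecondOrderClassStep` — binder row D1, hR side of the (0.4) ROOT: **THE CLASS STEP OF ROOT J's REMAINDER RECURSION `hR2succ`** —
# the right-hand side of `hR2succ` (sandwich of the symmetrised residual MINUS the four inner sandwich-defect words, transported by `mmRead`, plus
# the symbol commutator) is a `LocStencil₂` family at SOME rate, from separation-localised `(X2s, Δ)` at level `j` — generic kernels, then the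
# (0.4) literal `(Gsym Lc j, bhKStepSh 3 Lc (Dsh Lc) j)` over an1's tables
# (β sub-cell, D1 formalisation swarm, unit `b2b-balaban-beta-d1-formalise-leaf-03`, gen 17; the sym twin of leaf-05 g5's comb class step
# `SecondOrderClassStep.locStencil₂_R2succ` for the row-D1 OWNER an2's ROOT J `RowD1JointEndSymReflTablesAn1S2MWVB` (p299091), binder `hR2succ`)

NOT IN PRINT; OUR BOOKKEEPING.  HONEST FRAMING (cell contract, verbatim): «discharging `BetaPertH` makes Bałaban's UV stability
UNCONDITIONAL — a real constructive-QFT result; it is NOT the continuum limit and NOT the Clay problem.»  HONEST DEPENDENCY (verbatim):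
«continuum YM on T⁴ ⇐ BetaPertH ∧ nine spine estimates (0/9 proved); BetaPertH ⇐ (D1) ∧ (D4) ∧ CAP+tail; G-an2-4 gates asym, D1 and
NE2/3/4.»  [folklore] analysis bookkeeping over OUR objects; instantiates NO binder of the β-function wall; no `[cite:]`, no `def`, no `def … : Prop`;
NOT D1, NOT `BetaPertH`, NOT continuum, NOT Clay.

## What

ROOT J displays the remainder recursion (l.127–150)
`R2 (j+1) α κuκ′u′ = −(a_j • mmRead Lc (G_j ∘ V_j κuκ′u′ ∘ G_j − W_j κuκ′u′)) + 0 + conjV (mmRead Lc G_j) (diagK (a_j·mmSym Lc (X2s_j κuκ′u′) − w_j·h2_{j+1} κuκ′u′))`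
(`a_j = Lc⁸·wV4 (j+1)`, `w_j = wVH (j+1)`, `V_j` the symmetrised residual of `(X2s_j, Δ_j)`, `W_j` the four inner sandwich-defect words, `h2` the product
symbol).  The owner's (N11) ROOT K instantiates `R2 ∕ Δ` by this recursion; for the END the classes must propagate through it.  This file proves the
CLASS STEP: if at level `j` the free tables `diagK ∘ X2s_j` and `Δ_j` are separation-localised (leaf-05's currency: bi-localised at the dilated first bond
`Lc•u` with a constant decaying in `|Lc•u − Lc•u′|₁`), then `κuκ′u′ ↦ RHS` is a `LocStencil₂` family at some positive rate — for ANY remainder-border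
family `RB` of class `LocStencil₂` in place of ROOT J's `0`.
* §1 separation combinators over a decaying kernel: `sep_comp_decays_left ∕ _right`, **`sep_sandwich`** (`K ∘ P ∘ K`), `sep_sub`, and the
  undilation `locStencil₂_mmRead_of_sep` (dilated-separation currency ⟹ leaf-05's `SecondOrderStepRemainder.locStencil₂_mmRead`).
* §2 **`locStencil₂_R2succ_of_sep`** (generic `K`, `𝕄`, `S`, `M`, `g`, `N ≥ 1`): the RHS class from (hX)(hΔ), the border class, and the `LocStencil₂`
  class of the product symbol — `SecondOrderDefectWordsSep.sep_defectWords` (the four words), leaf-05's `SecondOrderSeparationCalculus.sep_symRem`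
  (the residual), `SecondOrderClassStep.locStencil₂_diagK_mmSym_of_sep` (the `mmSym` symbol), `SecondOrderStepRemainder.locStencil₂_stepRemainder`.
* §3 **`locStencil₂_R2succ_symTablesAn1`** — AT THE (0.4) LITERAL, ROOT J's RHS VERBATIM (`Gsym Lc j`, `bhKStepSh 3 Lc (Dsh Lc) j`, an1's tables, the
  symbol `(γ (j+1)·E_{κu})·(γ (j+1)·E_{κ′u′})`, border `0`), every `j`, `α`, `γ`, `cΛ`: classes of `X2s j α`, `Δ j α` in ⟹ class of `R2 (j+1) α` out
  (`SymSecondOrderSplitLoc.locStencil₂_diagK_ctGenM_mul_ctGenM` for the symbol, (DG)(Dspr) for the kernels).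
* §4 **`locStencil₂_symR2An1_succ`** — the same ON THE OWNER's (N11) recursive remainder `SymSecondOrderRemainderAn1.symR2An1` (ROOT K's `R2`): the
  `LocStencil₂` class of `symR2An1 … (j+1) α` from the separation classes of `X2s j α` and of the defined split defect `symΔAn1 … j α`.
Provenance: β sub-cell, unit `b2b-balaban-beta-d1-formalise-leaf-03` gen 17, 2026-08-21 (v1); no existing file touched.
-/

noncomputable section

open Finset
open scoped BigOperators
open Literature.MathematicalPhysics.QuantumFieldTheory
open Literature.MathematicalPhysics.QuantumFieldTheory.Balaban1983to89
open Literature.MathematicalPhysics.QuantumFieldTheory.Balaban1983to89.Beta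
open B12Sec2to5 (l1 l1_nonneg)
open ExpKernelCalculus (MKer Site Decays BiLoc VertexFamily comp Zl Zl_nonneg l1_sub_symm biLoc_comp_decays)
open KernelWard (biLoc_add biLoc_sub)
open AveragingContoursRooted (ctr ctrOff ctrOff_mem_box)
open OneStepResolventKernel (Fib LocStencil decays_mono biLoc_mono)
open OneStepKernelFamily (colH vertexOfK)
open BalabanStepJetsSucc (mmRead biLoc_comp_right l1_sub_le_l1_smul_sub wVH)
open BalabanStepW2 (biLoc_le_mono wV4)
open BalabanCompositeJets (LocStencil₂)
open SecondOrderResponse (dM biLoc_neg)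
open Summit.QuantumFields.BalabanUV.Beta.TameKernelCalculus
open Summit.QuantumFields.BalabanUV.Beta.ChartConjugation (conjV)
open Summit.QuantumFields.BalabanUV.Beta.ChartConjugationDefectEnd (sandwichDefect)
open Summit.QuantumFields.BalabanUV.Beta.AxialDressingRooted (one_le_of_neZero)
open Summit.QuantumFields.BalabanUV.Beta.BorderedHessian (bhK diagK spr_bhK)
open Summit.QuantumFields.BalabanUV.Beta.WardLocusCubic (mmSym)
open Summit.QuantumFields.BalabanUV.Beta.SecondOrderSeparationCalculus (sep_of_le sep_add sep_neg sep_swap sep_symRem)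
open Summit.QuantumFields.BalabanUV.Beta.SecondOrderStepRemainder (locStencil₂_mmRead locStencil₂_stepRemainder)
open Summit.QuantumFields.BalabanUV.Beta.SecondOrderClassStep (locStencil₂_diagK_mmSym_of_sep)
open Summit.QuantumFields.BalabanUV.Beta.SecondOrderDefectWordsSep (sep_defectWords)
open Summit.QuantumFields.BalabanUV.Beta.SymmetrisedStepJets (Gsym decays_Gsym)
open Summit.QuantumFields.BalabanUV.Beta.SpineRooted (M1Of SpureRecOf locStencil_SpureRecOf vertexFamily_M1Of)
open Summit.QuantumFields.BalabanUV.Beta.SymShiftedSpread (bhKStepSh spr_bhKStepSh)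
open Summit.QuantumFields.BalabanUV.Beta.RelInvNullShift (spr_add)
open Summit.QuantumFields.BalabanUV.Beta.DshAn1 (Dsh spr_Dsh)
open Summit.QuantumFields.BalabanUV.Beta.E3ContactGenerator (ctGenM)
open Summit.QuantumFields.BalabanUV.Beta.SymAveragingHessianCounts (symVhSAt symHessFFAt symVhSAt_hV_ctr symHessFFAt_hH_ctr)
open Summit.QuantumFields.BalabanUV.Beta.SymSecondOrderSplitLoc (locStencil_diagK_mul_ctGenM locStencil₂_diagK_ctGenM_mul_ctGenM)
open Summit.QuantumFields.BalabanUV.Beta.SymSecondOrderRemainderAn1 (symR2An1 symΔAn1 hR2succ_sym)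

namespace Summit.QuantumFields.BalabanUV.Beta.SymSecondOrderClassStep

variable {d N : ℕ}

/-! ## §1 Separation combinators over a decaying kernel -/

section Sep

variable {K : MKer (d + 1) (Fib d)} {P Q : Fin (d + 1) → (Fin (d + 1) → ℤ) → Fin (d + 1) → (Fin (d + 1) → ℤ) → MKer (d + 1) (Fib d)}

/-- [folklore] Left composition with a decaying kernel preserves separation-localisation. -/
theorem sep_comp_decays_left (hK : ∃ δ C : ℝ, 0 < δ ∧ 0 ≤ C ∧ Decays K C δ)
    (hP : ∃ C δ : ℝ, 0 < δ ∧ ∀ μ y ν y', BiLoc (P μ y ν y') ((N : ℤ) • y) ((N : ℤ) • y) (C * Real.exp (-δ * l1 ((N : ℤ) • y - (N : ℤ) • y'))) δ) :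
    ∃ C δ : ℝ, 0 < δ ∧ ∀ μ y ν y', BiLoc (comp K (P μ y ν y')) ((N : ℤ) • y) ((N : ℤ) • y)
      (C * Real.exp (-δ * l1 ((N : ℤ) • y - (N : ℤ) • y'))) δ := by
  obtain ⟨δK, CK, hδK, hCK, hKd⟩ := hK
  obtain ⟨C, δ, hδ, h⟩ := hP
  have hC : 0 ≤ C := by
    have := (h 0 0 0 0).nonneg (Sum.inl 0); simp [l1] at this; exact this
  set m : ℝ := min δK δ with hm_def
  have hm : 0 < m := lt_min hδK hδ
  have hKm : Decays K CK m := decays_mono hKd hCK le_rfl (min_le_left _ _)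
  have hZ : 0 ≤ Zl (d + 1) (m - m / 2) := Zl_nonneg (by linarith)
  refine ⟨(Fintype.card (Fib d) : ℝ) * (CK * C) * Zl (d + 1) (m - m / 2), m / 2, half_pos hm, fun μ y ν y' => ?_⟩
  have h1 := biLoc_comp_decays hKm (sep_of_le h hC (min_le_right _ _) μ y ν y') (half_pos hm).le (half_lt_self hm)
  refine biLoc_le_mono h1 (by positivity) ?_ le_rfl
  have e : (Fintype.card (Fib d) : ℝ) * (CK * (C * Real.exp (-m * l1 ((N : ℤ) • y - (N : ℤ) • y')))) * Zl (d + 1) (m - m / 2) =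
      (Fintype.card (Fib d) : ℝ) * (CK * C) * Zl (d + 1) (m - m / 2) * Real.exp (-m * l1 ((N : ℤ) • y - (N : ℤ) • y')) := by ring
  rw [e]
  exact mul_le_mul_of_nonneg_left (Real.exp_le_exp.2 (by nlinarith [l1_nonneg ((N : ℤ) • y - (N : ℤ) • y')])) (by positivity)

/-- [folklore] Right composition with a decaying kernel preserves separation-localisation. -/
theorem sep_comp_decays_right (hK : ∃ δ C : ℝ, 0 < δ ∧ 0 ≤ C ∧ Decays K C δ)
    (hP : ∃ C δ : ℝ, 0 < δ ∧ ∀ μ y ν y', BiLoc (P μ y ν y') ((N : ℤ) • y) ((N : ℤ) • y) (C * Real.exp (-δ * l1 ((N : ℤ) • y - (N : ℤ) • y'))) δ) :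
    ∃ C δ : ℝ, 0 < δ ∧ ∀ μ y ν y', BiLoc (comp (P μ y ν y') K) ((N : ℤ) • y) ((N : ℤ) • y)
      (C * Real.exp (-δ * l1 ((N : ℤ) • y - (N : ℤ) • y'))) δ := by
  obtain ⟨δK, CK, hδK, hCK, hKd⟩ := hK
  obtain ⟨C, δ, hδ, h⟩ := hP
  have hC : 0 ≤ C := by
    have := (h 0 0 0 0).nonneg (Sum.inl 0); simp [l1] at this; exact this
  set m : ℝ := min δK δ with hm_def
  have hm : 0 < m := lt_min hδK hδ
  have hKm : Decays K CK m := decays_mono hKd hCK le_rfl (min_le_left _ _)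
  have hZ : 0 ≤ Zl (d + 1) (m - m / 2) := Zl_nonneg (by linarith)
  refine ⟨(Fintype.card (Fib d) : ℝ) * (C * CK) * Zl (d + 1) (m - m / 2), m / 2, half_pos hm, fun μ y ν y' => ?_⟩
  have h1 := biLoc_comp_right (sep_of_le h hC (min_le_right _ _) μ y ν y') hKm (half_pos hm).le (half_lt_self hm)
  refine biLoc_le_mono h1 (by positivity) ?_ le_rfl
  have e : (Fintype.card (Fib d) : ℝ) * (C * Real.exp (-m * l1 ((N : ℤ) • y - (N : ℤ) • y')) * CK) * Zl (d + 1) (m - m / 2) =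
      (Fintype.card (Fib d) : ℝ) * (C * CK) * Zl (d + 1) (m - m / 2) * Real.exp (-m * l1 ((N : ℤ) • y - (N : ℤ) • y')) := by ring
  rw [e]
  exact mul_le_mul_of_nonneg_left (Real.exp_le_exp.2 (by nlinarith [l1_nonneg ((N : ℤ) • y - (N : ℤ) • y')])) (by positivity)

/-- [folklore] **THE `K`-SANDWICH OF A SEPARATION-LOCALISED FAMILY IS SEPARATION-LOCALISED**: `(b, c) ↦ K ∘ P b c ∘ K`. -/
theorem sep_sandwich (hK : ∃ δ C : ℝ, 0 < δ ∧ 0 ≤ C ∧ Decays K C δ)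
    (hP : ∃ C δ : ℝ, 0 < δ ∧ ∀ μ y ν y', BiLoc (P μ y ν y') ((N : ℤ) • y) ((N : ℤ) • y) (C * Real.exp (-δ * l1 ((N : ℤ) • y - (N : ℤ) • y'))) δ) :
    ∃ C δ : ℝ, 0 < δ ∧ ∀ μ y ν y', BiLoc (comp (comp K (P μ y ν y')) K) ((N : ℤ) • y) ((N : ℤ) • y)
      (C * Real.exp (-δ * l1 ((N : ℤ) • y - (N : ℤ) • y'))) δ :=
  sep_comp_decays_right hK (sep_comp_decays_left hK hP)

/-- [folklore] **DIFFERENCE** of two separation-localised families. -/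
theorem sep_sub
    (hP : ∃ C δ : ℝ, 0 < δ ∧ ∀ μ y ν y', BiLoc (P μ y ν y') ((N : ℤ) • y) ((N : ℤ) • y) (C * Real.exp (-δ * l1 ((N : ℤ) • y - (N : ℤ) • y'))) δ)
    (hQ : ∃ C δ : ℝ, 0 < δ ∧ ∀ μ y ν y', BiLoc (Q μ y ν y') ((N : ℤ) • y) ((N : ℤ) • y) (C * Real.exp (-δ * l1 ((N : ℤ) • y - (N : ℤ) • y'))) δ) :
    ∃ C δ : ℝ, 0 < δ ∧ ∀ μ y ν y', BiLoc (P μ y ν y' - Q μ y ν y') ((N : ℤ) • y) ((N : ℤ) • y)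
      (C * Real.exp (-δ * l1 ((N : ℤ) • y - (N : ℤ) • y'))) δ := by
  have h := sep_add hP (sep_neg hQ)
  simpa only [sub_eq_add_neg] using h

/-- [folklore] **UNDILATION + `mm`-READ**: a family separation-localised in the DILATED separation `|N•u − N•u′|₁` at the dilated first bond reads
through `mmRead N` as a `LocStencil₂` family (`l1 (u′ − u) ≤ l1 (N•u − N•u′)` for `N ≥ 1`; leaf-05's `SecondOrderStepRemainder.locStencil₂_mmRead`). -/
theorem locStencil₂_mmRead_of_sep (hN : 1 ≤ N)
    (hP : ∃ C δ : ℝ, 0 < δ ∧ ∀ μ y ν y', BiLoc (P μ y ν y') ((N : ℤ) • y) ((N : ℤ) • y) (C * Real.exp (-δ * l1 ((N : ℤ) • y - (N : ℤ) • y'))) δ) :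
    ∃ C δ : ℝ, 0 < δ ∧ LocStencil₂ (fun κ u κ' u' => mmRead N (P κ u κ' u')) C δ := by
  obtain ⟨C, δ, hδ, h⟩ := hP
  have hC : 0 ≤ C := by
    have := (h 0 0 0 0).nonneg (Sum.inl 0); simp [l1] at this; exact this
  refine ⟨C, δ, hδ, locStencil₂_mmRead hN hδ.le fun κ u κ' u' => ?_⟩
  refine biLoc_le_mono (h κ u κ' u') (by positivity) (mul_le_mul_of_nonneg_left (Real.exp_le_exp.2 ?_) hC) le_rfl
  have e : l1 (u' - u) ≤ l1 ((N : ℤ) • u - (N : ℤ) • u') := by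
    rw [l1_sub_symm u' u]; exact l1_sub_le_l1_smul_sub hN u u'
  nlinarith [hδ.le, e]

end Sep

/-! ## §2 The class step of the remainder recursion, generic kernels -/

section Generic

variable {K 𝕄 : MKer (d + 1) (Fib d)}

/-- [folklore] **THE CLASS STEP OF `hR2succ`, GENERIC KERNELS.**  Decaying `K`, `𝕄`; a local stencil family `S`; a vertex family `M`; a bi-localised
diagonal generator family `g`; free bond-pair tables `X2s` (symbols) and `Δ` (kernels) SEPARATION-LOCALISED; a border family `RB` of class
`LocStencil₂`; a symbol family `hB′` with `LocStencil₂ (κuκ′u′ ↦ diagK (hB′ κuκ′u′))`; scalars `a`, `w`; `N ≥ 1`.  Then the right-hand side of ROOT J's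
remainder recursion — `−(a • mmRead N (K ∘ V κuκ′u′ ∘ K − W κuκ′u′)) + RB κuκ′u′ + conjV (mmRead N K) (diagK (a·mmSym N (X2s κuκ′u′) − w·hB′ κuκ′u′))`,
`V` the symmetrised residual, `W` the four inner sandwich-defect words — is a `LocStencil₂` family at some positive rate. -/
theorem locStencil₂_R2succ_of_sep [NeZero N] (hN : 1 ≤ N) (hK : ∃ δ C : ℝ, 0 < δ ∧ 0 ≤ C ∧ Decays K C δ)
    (h𝕄 : ∃ δ C : ℝ, 0 < δ ∧ 0 ≤ C ∧ Decays 𝕄 C δ)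
    {S : Fin (d + 1) → (Fin (d + 1) → ℤ) → MKer (d + 1) (Fib d)} (hS : ∃ Cs δs : ℝ, 0 < δs ∧ LocStencil S Cs δs)
    {M : Fin (d + 1) → (Fin (d + 1) → ℤ) → MKer (d + 1) (Fib d)} (hM : ∃ CM δM : ℝ, 0 < δM ∧ VertexFamily M N CM δM)
    {g : Fin (d + 1) → (Fin (d + 1) → ℤ) → (Fin (d + 1) → ℤ) → Fib d → ℝ} (hgl : ∃ Cg δg : ℝ, 0 < δg ∧ LocStencil (fun κ u => diagK (g κ u)) Cg δg)
    {X2s : Fin (d + 1) → (Fin (d + 1) → ℤ) → Fin (d + 1) → (Fin (d + 1) → ℤ) → (Fin (d + 1) → ℤ) → Fib d → ℝ}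
    (hX : ∃ C δ : ℝ, 0 < δ ∧ ∀ μ y ν y', BiLoc (diagK (X2s μ y ν y')) ((N : ℤ) • y) ((N : ℤ) • y) (C * Real.exp (-δ * l1 ((N : ℤ) • y - (N : ℤ) • y'))) δ)
    {Δ : Fin (d + 1) → (Fin (d + 1) → ℤ) → Fin (d + 1) → (Fin (d + 1) → ℤ) → MKer (d + 1) (Fib d)}
    (hΔ : ∃ C δ : ℝ, 0 < δ ∧ ∀ μ y ν y', BiLoc (Δ μ y ν y') ((N : ℤ) • y) ((N : ℤ) • y) (C * Real.exp (-δ * l1 ((N : ℤ) • y - (N : ℤ) • y'))) δ)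
    {RB : Fin (d + 1) → (Fin (d + 1) → ℤ) → Fin (d + 1) → (Fin (d + 1) → ℤ) → MKer (d + 1) (Fib d)} (hBl : ∃ CB δB : ℝ, 0 < δB ∧ LocStencil₂ RB CB δB)
    {hB' : Fin (d + 1) → (Fin (d + 1) → ℤ) → Fin (d + 1) → (Fin (d + 1) → ℤ) → (Fin (d + 1) → ℤ) → Fib d → ℝ}
    (hbl : ∃ Cb δb : ℝ, 0 < δb ∧ LocStencil₂ (fun κ u κ' u' => diagK (hB' κ u κ' u')) Cb δb) (a w : ℝ) :
    ∃ C δ : ℝ, 0 < δ ∧ LocStencil₂ (fun κ u κ' u' =>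
      -(a • mmRead N
          (comp (comp K ((1 / 2 : ℝ) • conjV 𝕄 (diagK fun p a => X2s κ' u' κ u p a - X2s κ u κ' u' p a) +
              (1 / 2 : ℝ) • (Δ κ u κ' u' + Δ κ' u' κ u))) K -
            (comp (sandwichDefect K 𝕄 (diagK fun p c => ∑ ι, ∑' v, colH K N κ u ι v * g ι v p c))
                (comp (dM K N S M κ' u') K - diagK fun p c => ∑ ι, ∑' v, colH K N κ' u' ι v * g ι v p c)
              + comp (comp K (dM K N S M κ u + conjV 𝕄 (diagK fun p c => ∑ ι, ∑' v, colH K N κ u ι v * g ι v p c)))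
                (sandwichDefect K 𝕄 (diagK fun p c => ∑ ι, ∑' v, colH K N κ' u' ι v * g ι v p c))
              + comp (sandwichDefect K 𝕄 (diagK fun p c => ∑ ι, ∑' v, colH K N κ' u' ι v * g ι v p c))
                (comp (dM K N S M κ u) K - diagK fun p c => ∑ ι, ∑' v, colH K N κ u ι v * g ι v p c)
              + comp (comp K (dM K N S M κ' u' + conjV 𝕄 (diagK fun p c => ∑ ι, ∑' v, colH K N κ' u' ι v * g ι v p c)))
                (sandwichDefect K 𝕄 (diagK fun p c => ∑ ι, ∑' v, colH K N κ u ι v * g ι v p c))))) +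
        RB κ u κ' u' +
        conjV (mmRead N K) (diagK fun p c => a * mmSym N (X2s κ u κ' u') p c - w * hB' κ u κ' u' p c)) C δ := by
  -- the symmetrised residual and the defect words are separation-localised, hence so is `K ∘ V ∘ K − W`; transport by `mmRead`
  have hXd : ∃ C δ : ℝ, 0 < δ ∧ ∀ μ y ν y', BiLoc (diagK fun p a => X2s ν y' μ y p a - X2s μ y ν y' p a) ((N : ℤ) • y) ((N : ℤ) • y)
      (C * Real.exp (-δ * l1 ((N : ℤ) • y - (N : ℤ) • y'))) δ := by
    have h := sep_symRem (N := N) (P := Δ) (Q := fun μ y ν y' => diagK (X2s μ y ν y')) h𝕄 hΔ hX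
    -- only the `Q`-difference is needed here in diagonal form: re-derive it directly
    have h2 := sep_sub (N := N) (sep_swap hX) hX
    refine (h2.imp fun C hC => hC.imp fun δ hδ => ⟨hδ.1, fun μ y ν y' => ?_⟩)
    have e : (diagK fun p a => X2s ν y' μ y p a - X2s μ y ν y' p a) = diagK (X2s ν y' μ y) - diagK (X2s μ y ν y') := by
      classical
      funext x z e₁ e₂
      simp only [BorderedHessian.diagK_apply, Pi.sub_apply]
      split_ifs <;> simp
    rw [e]
    exact hδ.2 μ y ν y'
  have hV : ∃ C δ : ℝ, 0 < δ ∧ ∀ μ y ν y', BiLoc ((1 / 2 : ℝ) • conjV 𝕄 (diagK fun p a => X2s ν y' μ y p a - X2s μ y ν y' p a) +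
      (1 / 2 : ℝ) • (Δ μ y ν y' + Δ ν y' μ y)) ((N : ℤ) • y) ((N : ℤ) • y) (C * Real.exp (-δ * l1 ((N : ℤ) • y - (N : ℤ) • y'))) δ :=
    sep_add (SecondOrderSeparationCalculus.sep_smul _ (SecondOrderSeparationCalculus.sep_conjV h𝕄 hXd))
      (SecondOrderSeparationCalculus.sep_smul _ (sep_add hΔ (sep_swap hΔ)))
  have hR₀ := sep_sub (sep_sandwich hK hV) (sep_defectWords hK h𝕄 hS hM hgl)
  obtain ⟨C₀, δ₀, hδ₀, h₀⟩ := locStencil₂_mmRead_of_sep hN hR₀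
  -- the remaining classes, at a common rate
  obtain ⟨δK, CK, hδK, hCK, hKd⟩ := hK
  obtain ⟨CB, δB, hδB, hB⟩ := hBl
  obtain ⟨Ch, δh, hδh, hh⟩ := locStencil₂_diagK_mmSym_of_sep hN hX
  obtain ⟨Cb, δb, hδb, hb⟩ := hbl
  set m : ℝ := min (min δK δ₀) (min δB (min δh δb)) with hm_def
  have hm : 0 < m := lt_min (lt_min hδK hδ₀) (lt_min hδB (lt_min hδh hδb))
  have hmK : m ≤ δK := (min_le_left _ _).trans (min_le_left _ _)
  have hm0 : m ≤ δ₀ := (min_le_left _ _).trans (min_le_right _ _)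
  have hmB : m ≤ δB := (min_le_right _ _).trans (min_le_left _ _)
  have hmh : m ≤ δh := (min_le_right _ _).trans ((min_le_right _ _).trans (min_le_left _ _))
  have hmb : m ≤ δb := (min_le_right _ _).trans ((min_le_right _ _).trans (min_le_right _ _))
  have hKm : Decays K CK m := decays_mono hKd hCK le_rfl hmK
  have h₀m := h₀.mono (m := m) hm0
  have hBm := hB.mono (m := m) hmB
  have hhm := hh.mono (m := m) hmh
  have hbm := hb.mono (m := m) hmb
  exact ⟨_, m / 2, half_pos hm, locStencil₂_stepRemainder hN hm hKm h₀m hBm a w (hh := fun κ u κ' u' => mmSym N (X2s κ u κ' u')) hhm hbm⟩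

end Generic


/-! ## §3 The class step at the (0.4) literal: ROOT J's `hR2succ` right-hand side, verbatim -/

section Literal

variable {Lc : ℕ} [NeZero Lc]

/-- [folklore] The decay package of a spread kernel in the `∃ δ C, 0 < δ ∧ 0 ≤ C ∧ Decays` currency. -/
theorem pkg_of_spr {D : ℕ} {F : Type*} [Fintype F] {A : MKer D F} (hA : Spr A) : ∃ δ C : ℝ, 0 < δ ∧ 0 ≤ C ∧ Decays A C δ := by
  obtain ⟨C, δ, hδ, h⟩ := hA
  exact ⟨δ, |C|, hδ, abs_nonneg C, fun x z a b => (h x z a b).trans (mul_le_mul_of_nonneg_right (le_abs_self C) (Real.exp_pos _).le)⟩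

/-- [folklore] **THE CLASS STEP OF ROOT J's `hR2succ` AT THE (0.4) LITERAL.**  For every level `j`, axis `α`, every `γ`, `cΛ`, and free tables
`X2s`, `Δ` (ROOT J's binders, indexed by `(j, α)`): if `diagK ∘ X2s j α` and `Δ j α` are separation-localised at level `j`, then the right-hand side
of `hR2succ` — with `G_j = Gsym Lc j`, `𝕄_j = bhKStepSh 3 Lc (Dsh Lc) j`, an1's recursive pure stencils and multiplier tables, the dressed generator
`γ_j·E`, the product symbol `(γ_{j+1}·E_{κu})·(γ_{j+1}·E_{κ′u′})` and border remainder `0`, TOKEN FOR TOKEN as ROOT J displays it (tree l.128–150) —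
is a `LocStencil₂` family at some positive rate: the class of `R2 (j+1) α` once ROOT K defines `R2` by this recursion.  Uses (DG) `decays_Gsym`,
(Dspr) `spr_Dsh`, `spr_bhKStepSh`, `spr_bhK`, `locStencil_SpureRecOf` over (LV)(LH), `vertexFamily_M1Of`, and `SymSecondOrderSplitLoc` §1 ∕ §5 for
the generator and the product symbol; no `Odd Lc`, no lock, no letter. -/
theorem locStencil₂_R2succ_symTablesAn1 (cΛ : ℝ) (γ : ℕ → ℝ) (j : ℕ) (α : Fin 4)
    {X2s : ℕ → Fin 4 → Fin 4 → (Fin 4 → ℤ) → Fin 4 → (Fin 4 → ℤ) → (Fin 4 → ℤ) → Fib 3 → ℝ}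
    {Δ : ℕ → Fin 4 → Fin 4 → (Fin 4 → ℤ) → Fin 4 → (Fin 4 → ℤ) → MKer 4 (Fib 3)}
    (hX : ∃ C δ : ℝ, 0 < δ ∧ ∀ μ y ν y', BiLoc (diagK (X2s j α μ y ν y')) ((Lc : ℤ) • y) ((Lc : ℤ) • y)
      (C * Real.exp (-δ * l1 ((Lc : ℤ) • y - (Lc : ℤ) • y'))) δ)
    (hΔ : ∃ C δ : ℝ, 0 < δ ∧ ∀ μ y ν y', BiLoc (Δ j α μ y ν y') ((Lc : ℤ) • y) ((Lc : ℤ) • y)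
      (C * Real.exp (-δ * l1 ((Lc : ℤ) • y - (Lc : ℤ) • y'))) δ) :
    ∃ C δ : ℝ, 0 < δ ∧ LocStencil₂ (fun (κ : Fin 4) (u : Fin 4 → ℤ) (κ' : Fin 4) (u' : Fin 4 → ℤ) =>
          (-((((Lc : ℝ) ^ 8) * wV4 3 Lc (j + 1)) • mmRead Lc
              (comp (comp (Gsym Lc j) (((1 / 2 : ℝ) • conjV (bhKStepSh 3 Lc (Dsh Lc) j) (diagK fun p a => X2s j α κ' u' κ u p a - X2s j α κ u κ' u' p a) +
                (1 / 2 : ℝ) • (Δ j α κ u κ' u' + Δ j α κ' u' κ u)))) (Gsym Lc j) -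
                (comp (sandwichDefect (Gsym Lc j) (bhKStepSh 3 Lc (Dsh Lc) j)
                      (diagK fun p c => ∑ ι, ∑' v, colH (Gsym Lc j) Lc κ u ι v * (γ j * ctGenM 3 (bhK Lc + Dsh Lc) α Lc ι v p c)))
                    (comp (dM (Gsym Lc j) Lc (SpureRecOf 3 Lc (symVhSAt (ctr 4 Lc) 3 Lc rfl) (symHessFFAt (ctr 4 Lc) Lc) (Gsym Lc) ((Lc : ℝ) ^ 4) (-((Lc : ℝ) ^ 8 / 2)) cΛ j) (M1Of 3 Lc (symHessFFAt (ctr 4 Lc) Lc) cΛ j) κ' u') (Gsym Lc j) -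
                      diagK fun p c => ∑ ι, ∑' v, colH (Gsym Lc j) Lc κ' u' ι v * (γ j * ctGenM 3 (bhK Lc + Dsh Lc) α Lc ι v p c))
                  + comp (comp (Gsym Lc j) (dM (Gsym Lc j) Lc (SpureRecOf 3 Lc (symVhSAt (ctr 4 Lc) 3 Lc rfl) (symHessFFAt (ctr 4 Lc) Lc) (Gsym Lc) ((Lc : ℝ) ^ 4) (-((Lc : ℝ) ^ 8 / 2)) cΛ j) (M1Of 3 Lc (symHessFFAt (ctr 4 Lc) Lc) cΛ j) κ u +
                      conjV (bhKStepSh 3 Lc (Dsh Lc) j) (diagK fun p c => ∑ ι, ∑' v, colH (Gsym Lc j) Lc κ u ι v * (γ j * ctGenM 3 (bhK Lc + Dsh Lc) α Lc ι v p c))))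
                    (sandwichDefect (Gsym Lc j) (bhKStepSh 3 Lc (Dsh Lc) j)
                      (diagK fun p c => ∑ ι, ∑' v, colH (Gsym Lc j) Lc κ' u' ι v * (γ j * ctGenM 3 (bhK Lc + Dsh Lc) α Lc ι v p c)))
                  + comp (sandwichDefect (Gsym Lc j) (bhKStepSh 3 Lc (Dsh Lc) j)
                      (diagK fun p c => ∑ ι, ∑' v, colH (Gsym Lc j) Lc κ' u' ι v * (γ j * ctGenM 3 (bhK Lc + Dsh Lc) α Lc ι v p c)))
                    (comp (dM (Gsym Lc j) Lc (SpureRecOf 3 Lc (symVhSAt (ctr 4 Lc) 3 Lc rfl) (symHessFFAt (ctr 4 Lc) Lc) (Gsym Lc) ((Lc : ℝ) ^ 4) (-((Lc : ℝ) ^ 8 / 2)) cΛ j) (M1Of 3 Lc (symHessFFAt (ctr 4 Lc) Lc) cΛ j) κ u) (Gsym Lc j) -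
                      diagK fun p c => ∑ ι, ∑' v, colH (Gsym Lc j) Lc κ u ι v * (γ j * ctGenM 3 (bhK Lc + Dsh Lc) α Lc ι v p c))
                  + comp (comp (Gsym Lc j) (dM (Gsym Lc j) Lc (SpureRecOf 3 Lc (symVhSAt (ctr 4 Lc) 3 Lc rfl) (symHessFFAt (ctr 4 Lc) Lc) (Gsym Lc) ((Lc : ℝ) ^ 4) (-((Lc : ℝ) ^ 8 / 2)) cΛ j) (M1Of 3 Lc (symHessFFAt (ctr 4 Lc) Lc) cΛ j) κ' u' +
                      conjV (bhKStepSh 3 Lc (Dsh Lc) j) (diagK fun p c => ∑ ι, ∑' v, colH (Gsym Lc j) Lc κ' u' ι v * (γ j * ctGenM 3 (bhK Lc + Dsh Lc) α Lc ι v p c))))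
                    (sandwichDefect (Gsym Lc j) (bhKStepSh 3 Lc (Dsh Lc) j)
                      (diagK fun p c => ∑ ι, ∑' v, colH (Gsym Lc j) Lc κ u ι v * (γ j * ctGenM 3 (bhK Lc + Dsh Lc) α Lc ι v p c)))))) +
            (0 : ℕ → Fin 4 → Fin 4 → (Fin 4 → ℤ) → Fin 4 → (Fin 4 → ℤ) → MKer 4 (Fib 3)) (j + 1) α κ u κ' u' +
            conjV (mmRead Lc (Gsym (d := 3) Lc j))
              (diagK fun p c => ((Lc : ℝ) ^ 8) * wV4 3 Lc (j + 1) * mmSym Lc (X2s j α κ u κ' u') p c - wVH 3 Lc (j + 1) * ((γ (j + 1) * ctGenM 3 (bhK Lc + Dsh Lc) α Lc κ u p c) * (γ (j + 1) * ctGenM 3 (bhK Lc + Dsh Lc) α Lc κ' u' p c))))) C δ := by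
  have hL1 : 1 ≤ Lc := one_le_of_neZero Lc
  have hG : ∃ δ C : ℝ, 0 < δ ∧ 0 ≤ C ∧ Decays (Gsym (d := 3) Lc j) C δ := decays_Gsym Lc j
  have h𝕄 : ∃ δ C : ℝ, 0 < δ ∧ 0 ≤ C ∧ Decays (bhKStepSh 3 Lc (Dsh Lc) j) C δ := pkg_of_spr (spr_bhKStepSh (spr_Dsh hL1) j)
  obtain ⟨δB, CB, hδB, hCB, hBd⟩ := pkg_of_spr (spr_add (spr_bhK (d := 3) hL1) (spr_Dsh hL1))
  obtain ⟨C1, hH1⟩ := symHessFFAt_hH_ctr (d := 3) hL1 1 zero_le_one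
  have hS := locStencil_SpureRecOf (d := 3) hL1 (symVhSAt_hV_ctr (d := 3) hL1) (symHessFFAt_hH_ctr (d := 3) hL1) (decays_Gsym Lc)
    ((Lc : ℝ) ^ 4) (-((Lc : ℝ) ^ 8 / 2)) cΛ j
  have hM : ∃ CM δM : ℝ, 0 < δM ∧ VertexFamily (M1Of 3 Lc (symHessFFAt (ctr 4 Lc) Lc) cΛ j) Lc CM δM := ⟨_, 1, one_pos, vertexFamily_M1Of hH1 cΛ j⟩
  have hgl : ∃ Cg δg : ℝ, 0 < δg ∧ LocStencil (fun κ u => diagK fun p a => γ j * ctGenM 3 (bhK Lc + Dsh Lc) α Lc κ u p a) Cg δg :=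
    ⟨_, δB / 2, half_pos hδB, locStencil_diagK_mul_ctGenM hBd hδB.le (γ j) α Lc⟩
  have hBl : ∃ C δ : ℝ, 0 < δ ∧ LocStencil₂ (fun (κ : Fin 4) (u : Fin 4 → ℤ) (κ' : Fin 4) (u' : Fin 4 → ℤ) =>
      (0 : ℕ → Fin 4 → Fin 4 → (Fin 4 → ℤ) → Fin 4 → (Fin 4 → ℤ) → MKer 4 (Fib 3)) (j + 1) α κ u κ' u') C δ :=
    ⟨0, 1, one_pos, fun κ u κ' u' x z a b => by simp⟩
  have hbl : ∃ Cb δb : ℝ, 0 < δb ∧ LocStencil₂ (fun κ u κ' u' => diagK fun p c =>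
      (γ (j + 1) * ctGenM 3 (bhK Lc + Dsh Lc) α Lc κ u p c) * (γ (j + 1) * ctGenM 3 (bhK Lc + Dsh Lc) α Lc κ' u' p c)) Cb δb :=
    ⟨_, δB / 3, by positivity, locStencil₂_diagK_ctGenM_mul_ctGenM hBd hδB.le (γ (j + 1)) (γ (j + 1)) α Lc⟩
  exact locStencil₂_R2succ_of_sep hL1 hG h𝕄 hS hM hgl hX hΔ hBl hbl (((Lc : ℝ) ^ 8) * wV4 3 Lc (j + 1)) (wVH 3 Lc (j + 1))

end Literal


/-! ## §4 The class step ON THE OWNER's RECURSIVE REMAINDER `symR2An1` (N11, `SymSecondOrderRemainderAn1` p299523) -/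

section Recursive

variable {Lc : ℕ} [NeZero Lc]

/-- [folklore] **THE CLASS OF `symR2An1 … (j+1) α` FROM THE LEVEL-`j` SEPARATION CLASSES OF `X2s j α` AND `symΔAn1 … j α`**: the owner's recursive
remainder (ROOT K's `R2`) at level `j+1` is a `LocStencil₂` family at some positive rate once the free symbol table `X2s j α` (through `diagK`) and the
defined split defect `symΔAn1 … j α` are separation-localised at level `j` (§3 read through `SymSecondOrderRemainderAn1.hR2succ_sym`, which is `rfl`). -/
theorem locStencil₂_symR2An1_succ (N : ℕ) (cΛ : ℝ) (γ : ℕ → ℝ)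
    (X2s : ℕ → Fin 4 → Fin 4 → (Fin 4 → ℤ) → Fin 4 → (Fin 4 → ℤ) → (Fin 4 → ℤ) → Fib 3 → ℝ) (j : ℕ) (α : Fin 4)
    (hX : ∃ C δ : ℝ, 0 < δ ∧ ∀ μ y ν y', BiLoc (diagK (X2s j α μ y ν y')) ((Lc : ℤ) • y) ((Lc : ℤ) • y)
      (C * Real.exp (-δ * l1 ((Lc : ℤ) • y - (Lc : ℤ) • y'))) δ)
    (hΔ : ∃ C δ : ℝ, 0 < δ ∧ ∀ μ y ν y', BiLoc (symΔAn1 Lc N cΛ γ X2s j α μ y ν y') ((Lc : ℤ) • y) ((Lc : ℤ) • y)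
      (C * Real.exp (-δ * l1 ((Lc : ℤ) • y - (Lc : ℤ) • y'))) δ) :
    ∃ C δ : ℝ, 0 < δ ∧ LocStencil₂ (symR2An1 Lc N cΛ γ X2s (j + 1) α) C δ := by
  obtain ⟨C, δ, hδ, h⟩ := locStencil₂_R2succ_symTablesAn1 (Lc := Lc) cΛ γ j α (X2s := X2s) (Δ := symΔAn1 Lc N cΛ γ X2s) hX hΔ
  refine ⟨C, δ, hδ, fun κ u κ' u' => ?_⟩
  rw [hR2succ_sym]
  exact h κ u κ' u'

end Recursive

end Summit.QuantumFields.BalabanUV.Beta.SymSecondOrderClassStep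

end
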